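import Mathlib
import Summits.KontsevichZagierPeriods.Zeta5Search.Elimination.HalfShiftRaise
import Summits.KontsevichZagierPeriods.Zeta5Search.WedgeDictionaryRankThree
import HarnessLib

/-!
# The half-shift transport of the rank-three Casoratian (E-L19c, part 1; fam-elim gen 23)

HONEST FRAMING: systematic search; no irrationality claim unless certified — identities among the rational Taylor data
`D(b) = (U(b), W(b), V(b))` of the Ball–Rivoal family; nothing here is
about sizes or irrationality.

With the MEET `dictMeet_at` (`D₀·D(z+e₇) − A·D(z) − P·D(Hz) − Q·D(Hz+e₇) = 0`) and the RAISE `dictRaise_at`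
(`Θ₁·D(z) + Θ₂·D(z+e₇) + Θ₃·D(z+2e₇) − pr·D(Hz) = 0`), every 3 × 3 determinant of direction vectors taken from the
cluster
`{z, z+e₇, z+2e₇, Hz, Hz+e₇, Hz+2e₇}` (`H = hShift` raises the level and the slots `T = {4,5,7}`) is an explicit
rational
multiple of the slot-7 Casoratian `cas3 z = det(D(z), D(z+e₇), D(z+2e₇))`, by multilinearity alone.  This file
records:

* `tripleDet a b c` — the generic determinant with the cofactor pattern of `cas3` (`tripleDet_eq_cas3`);
* one `H`-column (from the RAISE): `pr·det(D(z+e₇), D(z+2e₇), D(Hz)) = Θ₁·cas3`, `pr·det(D(z), D(z+2e₇), D(Hz)) =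
−Θ₂·cas3`,
  `pr·det(D(z), D(z+e₇), D(Hz)) = Θ₃·cas3` (`tripleDet_raise_hi/mid/lo`);
* two `H`-columns (MEET + RAISE): `Q·pr·det(D(Hz), D(Hz+e₇), D(z+e₇)) = −A·Θ₃·cas3`,
  `Q·pr·det(D(Hz), D(Hz+e₇), D(z+2e₇)) = (D₀Θ₁ + AΘ₂)·cas3`, `Q·pr·det(D(z), D(Hz), D(Hz+e₇)) = −D₀·Θ₃·cas3`
  (`tripleDet_meet_lo/hi`, `tripleDet_meet_z`);
* three `H`-columns = **the transport of `cas3` under the half-shift**: `Q²·pr·cas3(Hz) = [D₀′(D₀Θ₁ + AΘ₂) +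
AA′Θ₃]·cas3(z)`
  with `D₀′ = D₀ − 1`, `A′ = A(z+e₇)` (`cas3_hShift_raw`), and the closed-form identity
  `D₀′(D₀Θ₁ + AΘ₂) + AA′Θ₃ = −Q²·π_T·pr_T` (`transportE`, stated with the common factor `A` divided out; one `ring` in the symmetric coordinates of
  `HalfShiftRaiseCore`), whence **`cas3_hShift_mul`**: `Q²·(pr·cas3(Hz)) = −Q²·(π_T·pr_T·cas3(z))` and, for `Q ≠ 0`
  (`meetQ_ne_zero`: automatic when `z₁+z₂+z₃+z₆ ≤ 2z₀+1`), **`cas3_hShift`**: `pr·cas3(Hz) = −π_T·pr_T·cas3(z)` with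
  `π_T = (z₄+1)(z₅+1)(z₇+1)`, `pr_T = (z₀−z₄−z₅)(z₀−z₄−z₇)(z₀−z₅−z₇)`, `pr = ∏_{j<k ∈ {1,2,3,6}} (z₀+1−z_j−z_k)` —
  the half-shift analogue of `cas3_bump6` / `cas3_dsShift` (`Elimination/PencilConnection`).
* on the way: `meetA` FACTORS, `A = (z₇+1)(z₀−z₄−z₇)(z₀−z₅−z₇)` (`meetA_factor`); `hShift` commutes with `bump _ 6`; and
  **`Θ₂` IS SHORT**: `Θ₂ = Q·B₃ − D₀·q(−z₇−1)`, `B₃ = (z₄+1)(z₅+1)(2z₀−z₁−z₂−z₃−z₆−z₇) − (z₇+2)(z₀−z₇)·d` (`raiseB3`,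
  `compactE`, `raiseTh2_compact`), so `D₀Θ₁ + AΘ₂ = A·Q·B₃` (`tripleDet_meet_hi'`).

Hypotheses throughout: `InBox z`, `1 ≤ dOf z`, `z 7 + 1 ≤ z 0` (those of `dictRaise_at`; they imply those of
`dictMeet_at`
at `z` and at `z + e₇`).  All `linear_combination` certificates were found and checked symbolically outside Lean first
(`HOME/pub-zeta5-fam-elim/g23/e19/probe42.py`, `probe43.py`); the kernel re-verifies them here.  Next (E-L19c part 2,
successor): gen-1's `DictBridge` for the cluster `{c, c+e₇, Hc, DSc}` by Cramer pairings of these determinants.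
-/

open Finset

namespace Summit.KontsevichZagierPeriods.Zeta5Search.Elimination

open Summit.KontsevichZagierPeriods.Zeta5Search.DualSeries (InBox)
open Summit.KontsevichZagierPeriods.Zeta5Search.WedgeDictionary

/-! ### The generic determinant and slot bookkeeping -/

/-- `det(D(a), D(b), D(c))` with the cofactor pattern of `cas3` (columns `D = (U, W, V)`). -/
noncomputable def tripleDet (a b c : ℕ → ℤ) : ℚ :=
  coeffU a * (coeffW b * coeffV c - coeffV b * coeffW c) - coeffW a * (coeffU b * coeffV c - coeffV b * coeffU c) +
    coeffV a * (coeffU b * coeffW c - coeffW b * coeffU c)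

/-- `cas3` is the slot-7 instance. -/
theorem tripleDet_eq_cas3 (b : ℕ → ℤ) : tripleDet b (bump b 6) (bump (bump b 6) 6) = cas3 b := rfl

/-- The values of `z + e₇ = bump z 6`. -/
theorem bump6_vals (z : ℕ → ℤ) :
    bump z 6 0 = z 0 ∧ bump z 6 1 = z 1 ∧ bump z 6 2 = z 2 ∧ bump z 6 3 = z 3 ∧ bump z 6 4 = z 4 ∧
      bump z 6 5 = z 5 ∧ bump z 6 6 = z 6 ∧ bump z 6 7 = z 7 + 1 :=
  ⟨bump_zero z 6, bump_of_ne z (by omega), bump_of_ne z (by omega), bump_of_ne z (by omega),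
    bump_of_ne z (by omega), bump_of_ne z (by omega), bump_of_ne z (by omega), bump_self z 6⟩

/-- `H` commutes with `+e₇`: `hShift (z + e₇) = hShift z + e₇`. -/
theorem hShift_bump6 (z : ℕ → ℤ) : hShift (bump z 6) = bump (hShift z) 6 := by
  funext j
  by_cases hj : j = 7
  · subst hj
    have h1 : bump z 6 7 = z 7 + 1 := bump_self z 6
    have h2 : bump (hShift z) 6 7 = hShift z 7 + 1 := bump_self (hShift z) 6
    rw [h2, hShift_seven, hShift_seven, h1]
  · have h1 : bump z 6 j = z j := bump_of_ne z (by omega)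
    have h2 : bump (hShift z) 6 j = hShift z j := bump_of_ne (hShift z) (by omega)
    rw [h2]
    simp only [hShift, h1]

/-- `D₀(z + e₇) = D₀(z) − 1`. -/
theorem meetD0_bump6 (z : ℕ → ℤ) : meetD0 (bump z 6) = meetD0 z - 1 := by
  obtain ⟨h0, -, -, -, h4, h5, -, h7⟩ := bump6_vals z
  unfold meetD0
  rw [h0, h4, h5, h7]
  push_cast
  ring

/-- `Q(z + e₇) = Q(z)` (`Q` does not involve slot 7). -/
theorem meetQ_bump6 (z : ℕ → ℤ) : meetQ (bump z 6) = meetQ z := by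
  obtain ⟨h0, h1, h2, h3, -, -, h6, -⟩ := bump6_vals z
  unfold meetQ
  rw [h0, h1, h2, h3, h6]

/-- `A` in the symmetric coordinates of `HalfShiftRaiseCore`: `A(z) = aForm (z₀+1) z₄ z₅ z₇`. -/
theorem meetA_eq_aForm (z : ℕ → ℤ) : meetA z = aForm (raiseM z) (z 4) (z 5) (z 7) := by
  unfold meetA meetD0 aForm raiseM; ring

/-- `A(z + e₇) = aForm (z₀+1) z₄ z₅ (z₇+1)`. -/
theorem meetA_bump6 (z : ℕ → ℤ) : meetA (bump z 6) = aForm (raiseM z) (z 4) (z 5) ((z 7 : ℚ) + 1) := by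
  obtain ⟨h0, -, -, -, h4, h5, -, h7⟩ := bump6_vals z
  unfold meetA meetD0 aForm raiseM
  rw [h0, h4, h5, h7]
  push_cast
  ring

/-- **`A` factors**: `A = (z₇+1)(z₀−z₄−z₇)(z₀−z₅−z₇)`. -/
theorem meetA_factor (z : ℕ → ℤ) :
    meetA z = ((z 7 : ℚ) + 1) * ((z 0 : ℚ) - z 4 - z 7) * ((z 0 : ℚ) - z 5 - z 7) := by
  unfold meetA meetD0; ring

/-- `π_T = (z₄+1)(z₅+1)(z₇+1)`, the raised-slot product. -/
def raisePiT (z : ℕ → ℤ) : ℚ := ((z 4 : ℚ) + 1) * ((z 5 : ℚ) + 1) * ((z 7 : ℚ) + 1)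

/-- `pr_T = (z₀−z₄−z₅)(z₀−z₄−z₇)(z₀−z₅−z₇)`, the pair product over the raised slots. -/
def raisePrT (z : ℕ → ℤ) : ℚ := ((z 0 : ℚ) - z 4 - z 5) * ((z 0 : ℚ) - z 4 - z 7) * ((z 0 : ℚ) - z 5 - z 7)

/-- `B₃ = (z₄+1)(z₅+1)(2z₀ − z₁ − z₂ − z₃ − z₆ − z₇) − (z₇+2)(z₀ − z₇)·d`, the cubic in the compact form of `Θ₂`. -/
def raiseB3 (z : ℕ → ℤ) : ℚ :=
  ((z 4 : ℚ) + 1) * ((z 5 : ℚ) + 1) * (2 * (z 0 : ℚ) - z 1 - z 2 - z 3 - z 6 - z 7) -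
    ((z 7 : ℚ) + 2) * ((z 0 : ℚ) - z 7) * raiseD z

/-- The compact form of `Θ₂` in the symmetric coordinates: `D₀·q(−z₇−1) + Θ₂ = Q·B₃`. -/
theorem compactE (M e1 e2 e3 z4 z5 z7 : ℚ) :
    (M - 2 - z4 - z5 - z7) * qForm M e1 e2 e3 (-(z7 + 1)) + th2Form M e1 e2 e3 z7 (z4 + z5) (z4 * z5) =
      (2 * M - e1) * ((z4 + 1) * (z5 + 1) * (2 * (M - 1) - (4 * M - e1) - z7) -
        (z7 + 2) * (M - 1 - z7) * (e1 - M - 3 - z4 - z5 - z7)) := by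
  unfold qForm th2Form; ring

/-- **`Θ₂` is short**: `Θ₂ = Q·B₃ − D₀·q(−z₇−1)`.  Hence the RAISE reads
`pr·D(Hz) = q(−z₇−1)·[A·D(z) − D₀·D(z+e₇)] + Q·[B₃·D(z+e₇) + d·D(z+2e₇)]` (found from the BRIDGE bookkeeping, `e19/probe45`). -/
theorem raiseTh2_compact (z : ℕ → ℤ) : raiseTh2 z = meetQ z * raiseB3 z - meetD0 z * raiseQ z (-((z 7 : ℚ) + 1)) := by
  have hE := compactE (raiseM z) (raiseE1 z) (raiseE2 z) (raiseE3 z) (z 4) (z 5) (z 7)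
  have hQ : meetQ z = 2 * raiseM z - raiseE1 z := by unfold meetQ raiseE1 raiseM uOf; ring
  have hD0 : meetD0 z = raiseM z - 2 - z 4 - z 5 - z 7 := by unfold meetD0 raiseM; ring
  have hB : raiseB3 z = ((z 4 : ℚ) + 1) * ((z 5 : ℚ) + 1) * (2 * (raiseM z - 1) - (4 * raiseM z - raiseE1 z) - z 7) -
      ((z 7 : ℚ) + 2) * (raiseM z - 1 - z 7) * (raiseE1 z - raiseM z - 3 - z 4 - z 5 - z 7) := by
    unfold raiseB3 raiseD raiseE1 raiseM uOf; ring
  unfold raiseTh2 raiseQ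
  rw [hQ, hD0, hB]
  linear_combination hE

/-! ### One `H`-column: the RAISE by multilinearity -/

/-- `pr·det(D(z+e₇), D(z+2e₇), D(Hz)) = Θ₁·cas3(z)`. -/
theorem tripleDet_raise_hi (z : ℕ → ℤ) (hz : InBox z) (hd : 1 ≤ dOf z) (h7 : z 7 + 1 ≤ z 0) :
    raisePr z * tripleDet (bump z 6) (bump (bump z 6) 6) (hShift z) = raiseTh1 z * cas3 z := by
  obtain ⟨⟨hU, hW⟩, hV⟩ := dictRaise_at z hz hd h7
  unfold tripleDet cas3
  linear_combination (-(coeffW (bump z 6) * coeffV (bump (bump z 6) 6) - coeffV (bump z 6) * coeffW (bump (bump z 6) 6))) * hU +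
      (-(coeffV (bump z 6) * coeffU (bump (bump z 6) 6) - coeffU (bump z 6) * coeffV (bump (bump z 6) 6))) * hW +
      (-(coeffU (bump z 6) * coeffW (bump (bump z 6) 6) - coeffW (bump z 6) * coeffU (bump (bump z 6) 6))) * hV

/-- `pr·det(D(z), D(z+2e₇), D(Hz)) = −Θ₂·cas3(z)`. -/
theorem tripleDet_raise_mid (z : ℕ → ℤ) (hz : InBox z) (hd : 1 ≤ dOf z) (h7 : z 7 + 1 ≤ z 0) :
    raisePr z * tripleDet z (bump (bump z 6) 6) (hShift z) = -(raiseTh2 z * cas3 z) := by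
  obtain ⟨⟨hU, hW⟩, hV⟩ := dictRaise_at z hz hd h7
  unfold tripleDet cas3
  linear_combination (-(coeffW z * coeffV (bump (bump z 6) 6) - coeffV z * coeffW (bump (bump z 6) 6))) * hU +
      (-(coeffV z * coeffU (bump (bump z 6) 6) - coeffU z * coeffV (bump (bump z 6) 6))) * hW +
      (-(coeffU z * coeffW (bump (bump z 6) 6) - coeffW z * coeffU (bump (bump z 6) 6))) * hV

/-- `pr·det(D(z), D(z+e₇), D(Hz)) = Θ₃·cas3(z)` (`Θ₃ = d·Q`). -/
theorem tripleDet_raise_lo (z : ℕ → ℤ) (hz : InBox z) (hd : 1 ≤ dOf z) (h7 : z 7 + 1 ≤ z 0) :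
    raisePr z * tripleDet z (bump z 6) (hShift z) = raiseTh3 z * cas3 z := by
  obtain ⟨⟨hU, hW⟩, hV⟩ := dictRaise_at z hz hd h7
  unfold tripleDet cas3
  linear_combination (-(coeffW z * coeffV (bump z 6) - coeffV z * coeffW (bump z 6))) * hU +
      (-(coeffV z * coeffU (bump z 6) - coeffU z * coeffV (bump z 6))) * hW +
      (-(coeffU z * coeffW (bump z 6) - coeffW z * coeffU (bump z 6))) * hV

/-! ### Two `H`-columns: the MEET, then the RAISE -/

/-- `Q·pr·det(D(Hz), D(Hz+e₇), D(z+e₇)) = −A·Θ₃·cas3(z)`. -/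
theorem tripleDet_meet_lo (z : ℕ → ℤ) (hz : InBox z) (hd : 1 ≤ dOf z) (h7 : z 7 + 1 ≤ z 0) :
    meetQ z * (raisePr z * tripleDet (hShift z) (bump (hShift z) 6) (bump z 6)) =
      -(meetA z * raiseTh3 z * cas3 z) := by
  obtain ⟨⟨mU, mW⟩, mV⟩ := dictMeet_at z hz (by omega) (by omega)
  have s3 := tripleDet_raise_lo z hz hd h7
  unfold tripleDet cas3 at s3 ⊢
  linear_combination (-(raisePr z * (coeffW (bump z 6) * coeffV (hShift z) - coeffV (bump z 6) * coeffW (hShift z)))) * mU +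
      (-(raisePr z * (coeffV (bump z 6) * coeffU (hShift z) - coeffU (bump z 6) * coeffV (hShift z)))) * mW +
      (-(raisePr z * (coeffU (bump z 6) * coeffW (hShift z) - coeffW (bump z 6) * coeffU (hShift z)))) * mV +
      (-meetA z) * s3

/-- `Q·pr·det(D(Hz), D(Hz+e₇), D(z+2e₇)) = (D₀Θ₁ + AΘ₂)·cas3(z)`. -/
theorem tripleDet_meet_hi (z : ℕ → ℤ) (hz : InBox z) (hd : 1 ≤ dOf z) (h7 : z 7 + 1 ≤ z 0) :
    meetQ z * (raisePr z * tripleDet (hShift z) (bump (hShift z) 6) (bump (bump z 6) 6)) =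
      (meetD0 z * raiseTh1 z + meetA z * raiseTh2 z) * cas3 z := by
  obtain ⟨⟨mU, mW⟩, mV⟩ := dictMeet_at z hz (by omega) (by omega)
  have s1 := tripleDet_raise_hi z hz hd h7
  have s2 := tripleDet_raise_mid z hz hd h7
  unfold tripleDet cas3 at s1 s2 ⊢
  linear_combination (-(raisePr z * (coeffW (bump (bump z 6) 6) * coeffV (hShift z) - coeffV (bump (bump z 6) 6) * coeffW (hShift z)))) * mU +
      (-(raisePr z * (coeffV (bump (bump z 6) 6) * coeffU (hShift z) - coeffU (bump (bump z 6) 6) * coeffV (hShift z)))) * mW +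
      (-(raisePr z * (coeffU (bump (bump z 6) 6) * coeffW (hShift z) - coeffW (bump (bump z 6) 6) * coeffU (hShift z)))) * mV +
      meetD0 z * s1 + (-meetA z) * s2

/-- Compact form: `Q·pr·det(D(Hz), D(Hz+e₇), D(z+2e₇)) = A·Q·B₃·cas3(z)` (`D₀Θ₁ + AΘ₂ = A·Q·B₃`). -/
theorem tripleDet_meet_hi' (z : ℕ → ℤ) (hz : InBox z) (hd : 1 ≤ dOf z) (h7 : z 7 + 1 ≤ z 0) :
    meetQ z * (raisePr z * tripleDet (hShift z) (bump (hShift z) 6) (bump (bump z 6) 6)) =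
      meetA z * meetQ z * raiseB3 z * cas3 z := by
  rw [tripleDet_meet_hi z hz hd h7, raiseTh2_compact]
  unfold raiseTh1
  ring

/-- `Q·pr·det(D(z), D(Hz), D(Hz+e₇)) = −D₀·Θ₃·cas3(z)`. -/
theorem tripleDet_meet_z (z : ℕ → ℤ) (hz : InBox z) (hd : 1 ≤ dOf z) (h7 : z 7 + 1 ≤ z 0) :
    meetQ z * (raisePr z * tripleDet z (hShift z) (bump (hShift z) 6)) = -(meetD0 z * raiseTh3 z * cas3 z) := by
  obtain ⟨⟨mU, mW⟩, mV⟩ := dictMeet_at z hz (by omega) (by omega)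
  have s3 := tripleDet_raise_lo z hz hd h7
  unfold tripleDet cas3 at s3 ⊢
  linear_combination (-(raisePr z * (coeffW z * coeffV (hShift z) - coeffV z * coeffW (hShift z)))) * mU +
      (-(raisePr z * (coeffV z * coeffU (hShift z) - coeffU z * coeffV (hShift z)))) * mW +
      (-(raisePr z * (coeffU z * coeffW (hShift z) - coeffW z * coeffU (hShift z)))) * mV + (-meetD0 z) * s3

/-! ### Three `H`-columns: the transport of `cas3` -/

/-- Raw transport: `Q·(Q·(pr·cas3(Hz))) = [D₀(z+e₇)·(D₀Θ₁ + AΘ₂) + A·A(z+e₇)·Θ₃]·cas3(z)` — the MEET at `z + e₇` expresses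
`Q·D(Hz+2e₇)` through `D(z+2e₇)`, `D(z+e₇)`, `D(Hz+e₇)`, and the two-`H`-column determinants above finish. -/
theorem cas3_hShift_raw (z : ℕ → ℤ) (hz : InBox z) (hd : 1 ≤ dOf z) (h7 : z 7 + 1 ≤ z 0) :
    meetQ z * (meetQ z * (raisePr z * cas3 (hShift z))) =
      (meetD0 (bump z 6) * (meetD0 z * raiseTh1 z + meetA z * raiseTh2 z) +
          meetA z * meetA (bump z 6) * raiseTh3 z) * cas3 z := by
  obtain ⟨hb0, -, -, -, -, -, -, hb7⟩ := bump6_vals z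
  have h7w : z 7 ≤ z 0 := by omega
  have hz' : InBox (bump z 6) := (box_update z hz (by omega) (show 6 ∈ range 7 by simp) h7w).1
  have hd' : 0 ≤ dOf (bump z 6) := by rw [dOf_bump z (show 6 ∈ range 7 by simp)]; omega
  have h7' : bump z 6 7 ≤ bump z 6 0 := by rw [hb7, hb0]; omega
  obtain ⟨⟨nU, nW⟩, nV⟩ := dictMeet_at (bump z 6) hz' hd' h7'
  rw [hShift_bump6, meetQ_bump6] at nU nW nV
  have s4a := tripleDet_meet_lo z hz hd h7
  have s4b := tripleDet_meet_hi z hz hd h7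
  unfold tripleDet at s4a s4b
  unfold cas3 at s4a s4b ⊢
  linear_combination (-(meetQ z * raisePr z * (coeffW (hShift z) * coeffV (bump (hShift z) 6) - coeffV (hShift z) * coeffW (bump (hShift z) 6)))) * nU +
      (-(meetQ z * raisePr z * (coeffV (hShift z) * coeffU (bump (hShift z) 6) - coeffU (hShift z) * coeffV (bump (hShift z) 6)))) * nW +
      (-(meetQ z * raisePr z * (coeffU (hShift z) * coeffW (bump (hShift z) 6) - coeffW (hShift z) * coeffU (bump (hShift z) 6)))) * nV +
      meetD0 (bump z 6) * s4b + (-meetA (bump z 6)) * s4a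

/-- The closed-form identity behind the transport, in the symmetric coordinates of `HalfShiftRaiseCore`
(`M = z₀+1`, `eₖ = eₖ(u)`, `D₀ = M−2−z₄−z₅−z₇`, `Q = 2M−e₁`, `d = e₁−M−3−z₄−z₅−z₇`, `A′ = aForm M z₄ z₅ (z₇+1)`), with the
common factor `A` divided out: `(D₀−1)(D₀·q(−z₇−1) + Θ₂) + A′·d·Q = −Q²·(z₄+1)(z₅+1)(M−1−z₄−z₅)`. -/
theorem transportE (M e1 e2 e3 z4 z5 z7 : ℚ) :
    (M - 2 - z4 - z5 - z7 - 1) *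
          ((M - 2 - z4 - z5 - z7) * qForm M e1 e2 e3 (-(z7 + 1)) + th2Form M e1 e2 e3 z7 (z4 + z5) (z4 * z5)) +
        aForm M z4 z5 (z7 + 1) * ((e1 - M - 3 - z4 - z5 - z7) * (2 * M - e1)) =
      -((2 * M - e1) ^ 2 * ((z4 + 1) * (z5 + 1) * (M - 1 - z4 - z5))) := by
  unfold aForm qForm th2Form; ring

/-- **Transport of the rank-three Casoratian under the half-shift** (multiplied by `Q²`):
`Q²·(pr·cas3(Hz)) = −Q²·(π_T·pr_T·cas3(z))`.  (`transportE` times the factored `A = (z₇+1)(z₀−z₄−z₇)(z₀−z₅−z₇)`, whose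
last two factors are the slot-7 part of `pr_T`.) -/
theorem cas3_hShift_mul (z : ℕ → ℤ) (hz : InBox z) (hd : 1 ≤ dOf z) (h7 : z 7 + 1 ≤ z 0) :
    meetQ z ^ 2 * (raisePr z * cas3 (hShift z)) = -(meetQ z ^ 2 * (raisePiT z * raisePrT z * cas3 z)) := by
  have h5 := cas3_hShift_raw z hz hd h7
  have hE := transportE (raiseM z) (raiseE1 z) (raiseE2 z) (raiseE3 z) (z 4) (z 5) (z 7)
  have hD0 : meetD0 z = raiseM z - 2 - z 4 - z 5 - z 7 := by unfold meetD0 raiseM; ring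
  have hD0' : meetD0 (bump z 6) = raiseM z - 2 - z 4 - z 5 - z 7 - 1 := by rw [meetD0_bump6, hD0]
  have hA' := meetA_bump6 z
  have hAf : meetA z = ((z 7 : ℚ) + 1) * (raiseM z - 1 - z 4 - z 7) * (raiseM z - 1 - z 5 - z 7) := by
    rw [meetA_factor]; unfold raiseM; ring
  have hQ : meetQ z = 2 * raiseM z - raiseE1 z := by unfold meetQ raiseE1 raiseM uOf; ring
  have hD : raiseD z = raiseE1 z - raiseM z - 3 - z 4 - z 5 - z 7 := by unfold raiseD raiseE1 raiseM uOf; ring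
  have hPi : raisePiT z = ((z 4 : ℚ) + 1) * ((z 5 : ℚ) + 1) * ((z 7 : ℚ) + 1) := rfl
  have hPr : raisePrT z = (raiseM z - 1 - z 4 - z 5) * (raiseM z - 1 - z 4 - z 7) * (raiseM z - 1 - z 5 - z 7) := by
    unfold raisePrT raiseM; ring
  have hT1 : raiseTh1 z = meetA z * raiseQ z (-((z 7 : ℚ) + 1)) := rfl
  have hT3 : raiseTh3 z = raiseD z * meetQ z := rfl
  rw [hT1, hT3, hD0', hD0, hA', hD, hQ] at h5
  unfold raiseQ raiseTh2 at h5
  rw [hQ, hPi, hPr]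
  linear_combination h5 + (meetA z * cas3 z) * hE +
      (-((2 * raiseM z - raiseE1 z) ^ 2 * (((z 4 : ℚ) + 1) * ((z 5 : ℚ) + 1) * (raiseM z - 1 - z 4 - z 5)) * cas3 z)) * hAf

/-- `Q ≠ 0` on the useful part of the box (`z₁+z₂+z₃+z₆ ≤ 2z₀+1`, e.g. under the pair condition `z_j + z_k ≤ z₀`). -/
theorem meetQ_ne_zero (z : ℕ → ℤ) (h : z 1 + z 2 + z 3 + z 6 ≤ 2 * z 0 + 1) : meetQ z ≠ 0 := by
  have h' : (z 1 : ℚ) + z 2 + z 3 + z 6 ≤ 2 * z 0 + 1 := by exact_mod_cast h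
  unfold meetQ
  intro h0
  linarith

/-- **Transport of the rank-three Casoratian under the half-shift**: for `Q ≠ 0`,
`pr·cas3(Hz) = −π_T·pr_T·cas3(z)`, i.e. `cas3(Hz)/cas3(z) = −(z₄+1)(z₅+1)(z₇+1)·(z₀−z₄−z₅)(z₀−z₄−z₇)(z₀−z₅−z₇) /
∏_{j<k∈{1,2,3,6}}(z₀+1−z_j−z_k)` wherever the denominators are non-zero. -/
theorem cas3_hShift (z : ℕ → ℤ) (hz : InBox z) (hd : 1 ≤ dOf z) (h7 : z 7 + 1 ≤ z 0) (hQ : meetQ z ≠ 0) :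
    raisePr z * cas3 (hShift z) = -(raisePiT z * raisePrT z * cas3 z) := by
  have h := cas3_hShift_mul z hz hd h7
  have hQ2 : meetQ z ^ 2 ≠ 0 := pow_ne_zero 2 hQ
  apply mul_left_cancel₀ hQ2
  linear_combination h

end Summit.KontsevichZagierPeriods.Zeta5Search.Elimination
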